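import Summits.RiemannHypothesis.RiemannHypothesis.Theorems.SuzukiFlowPairing
import Summits.RiemannHypothesis.RiemannHypothesis.Theorems.SuzukiThetaFlowDecayDefs
import Summits.RiemannHypothesis.RiemannHypothesis.Theorems.PfPersistenceGalerkinFormTests
import Literature.NumberTheory.LFunctions.WeilWindowSuzukiContinuityProofs
import Literature.NumberTheory.LFunctions.WeilGroundStateRealZerosProofs

/-!
# SuzukiThetaFlowOutputsCoercive — `OutputsCoercive` PROVED: Weil's ground energy is coercive on the θ-flow window
# outputs (column DBR; RH-FREE)

LINE 1 — LABEL: RH-FREE functional analysis (extension of Weil's quadratic form by continuity from smooth tests to one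
explicit family of rough functions; no sign of `ε(t)` is asserted); bears_on: LADDER-RH B-P(P2-flow) (provisional id,
fallback B-P(P2)).  WHAT THIS IS NOT: not a positivity statement, not a statement about zeros, not evidence for or
against RH; the `∀ t` antitone / clean-window level of the chain is Weil's criterion re-indexed (RH-EQUIVALENT, declared
by the card `theta-flow-weil-window`, NOT claimed); nothing here is progress toward RH.

THE STATEMENT (theory round-2 crux K2 `OutputsCoercive`, rh-dbr-theory g10, HOME/rh-dbr-theory/round2/Sketch.lean,
typed there verbatim): for every window half-width `t > 0`, every `θ > 1` and every `f ∈ L²(−t,t)`,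

  `ε(t) · ‖g_θ‖²_{L²} ≤ Re Q(g_θ)`,   `g_θ = winOut θ t f = 𝟙_{(−t,t)}·𝖪_θ[t]f`,  `‖g_θ‖² = winNormSq (limKernel θ) t f`,

`ε(t) = weilGroundEnergy t` the infimum of `Re Q` over the `L²`-unit sphere of SMOOTH tests supported in `[−t,t]`
(Bombieri 2000 §4), `Q = weilQuadratic`.

PROOF (mollification; every tool is a tree theorem): with the tree's mollifiers `φ_k` (`WeilContinuous.moll`, radius
`r_k = 1/(k+1)`) the functions `g_k = g_θ ⋆ φ_k` are Weil test functions supported in `[−t−r_k, t+r_k]`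
(`PfPersistence.isWeilTest_weilConv_moll_of_locallyIntegrable`, `PfPersistence.tsupport_weilConv_moll_subset`), so
`ε(t+r_k)·‖g_k‖² ≤ Re Q(g_k)` by the definition of `ε` as an infimum + homogeneity
(`ConnesVanSuijlekom.weilGroundEnergy_mul_le_re`).  By the autocorrelation identity
`g_k ⋆ g̃_k = (g_θ ⋆ g̃_θ) ⋆ ν_k`, `ν_k = φ_k ⋆ φ_k` (`PfPersistence.autocorr_weilConv_moll`), `Q(g_k) = W(φ ⋆ ν_k)` and
`‖g_k‖² = (φ ⋆ ν_k)(0)` with `φ = g_θ ⋆ g̃_θ` continuous with compact support (eng g6: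
`continuous_autocorr_winOut`, `hasCompactSupport_weilConv_winOut_weilReflect`) whose archimedean integrand
`φ̂(½+iy)·Re ψ(¼+iy/2)` is integrable (eng g6: `hasSum_weilArchIntegral_winOut`, Bombieri's series by Fatou); hence
`W(φ ⋆ ν_k) → W(φ) = Q(g_θ)` and `(φ ⋆ ν_k)(0) → φ(0) = ‖g_θ‖²` (`PfPersistence.tendsto_weilFunctional_mollSq`,
`PfPersistence.tendsto_weilConv_mollSq_zero`), while `ε(t+r_k) → ε(t)` by the CONTINUITY of the ground energy
(`continuousAt_weilGroundEnergy`, [Su26] Thm 1.3, a tree theorem).  Pass to the limit in the inequality.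

COROLLARY (the card's extension step): `WeilNonnegOnOutputs t` for EVERY real `t` (`WeilPositivityOn t ⇒ ε(t) ≥ 0`
by `weilGroundEnergy_nonneg_iff_holds`; windows `t ≤ 0` are empty).

References: A. Weil (1952); E. Bombieri, Rend. Lincei (9) 11 (2000) §4; [Su20] M. Suzuki, ASPM 84 (2020) (1.4);
M. Suzuki, *Weil's quadratic form via the screw function*, arXiv:2606.09096 (2026) Thm 1.3 (continuity of `ε`; PROVED in
the tree: `continuousAt_weilGroundEnergy`, `WeilWindowSuzukiContinuityProofs`).
-/

noncomputable section

-- D-0017: `Summit.<S>.<S>.…` is the designed namespace of a single-problem summit.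
set_option linter.dupNamespace false

open Complex MeasureTheory Set Filter Topology
open scoped Real

namespace Summit.RiemannHypothesis.RiemannHypothesis.Theorems.SuzukiThetaFlow

open Literature.NumberTheory.LFunctions Literature.NumberTheory.LFunctions.WeilContinuous
open Summit.RiemannHypothesis.RiemannHypothesis.Theorems.PfPersistence

variable {θ t : ℝ} {f : ℝ → ℝ}

/-! ## §1 The window output as an argument of the mollification engine -/

/-- RH-FREE.  `L²(−t,t) ⊆ L¹(−t,t)` (finite window). -/
theorem integrableOn_of_memLp_winMeasure (hf : MemLp f 2 (winMeasure t)) : IntegrableOn f (Ioo (-t) t) := by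
  haveI : IsFiniteMeasure (winMeasure t) := by unfold winMeasure; infer_instance
  exact hf.integrable one_le_two

/-- RH-FREE.  The window output `g_θ` is measurable (`𝖪_θ[t]f` is continuous). -/
theorem measurable_winOut (hθ : 1 < θ) (hf : IntegrableOn f (Ioo (-t) t)) : Measurable (winOut θ t f) :=
  Complex.measurable_ofReal.comp (((continuous_winOp hθ hf).measurable).indicator measurableSet_Ioo)

/-- RH-FREE.  `g_θ` vanishes off `[−t, t]`, in the radial form used by the mollification engine. -/
theorem winOut_eq_zero_of_lt_abs {x : ℝ} (hx : t < |x|) : winOut θ t f x = 0 :=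
  winOut_eq_zero_of_not_mem fun h ↦ by
    have : |x| < t := abs_lt.2 ⟨h.1, h.2⟩
    linarith

/-- RH-FREE.  `g_θ` has compact support (inside `[−t,t]`). -/
theorem hasCompactSupport_winOut (θ t : ℝ) (f : ℝ → ℝ) : HasCompactSupport (winOut θ t f) :=
  HasCompactSupport.intro (isCompact_Icc : IsCompact (Icc (-t) t)) fun _ hx ↦
    winOut_eq_zero_of_not_mem fun h ↦ hx (Ioo_subset_Icc_self h)

/-- RH-FREE.  `g_θ` is bounded. -/
theorem exists_norm_winOut_le (hθ : 1 < θ) (hf : IntegrableOn f (Ioo (-t) t)) :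
    ∃ M : ℝ, ∀ x : ℝ, ‖winOut θ t f x‖ ≤ M := by
  obtain ⟨M, hM0, hM⟩ := exists_abs_winOp_le hθ hf
  refine ⟨M, fun x ↦ ?_⟩
  by_cases hx : x ∈ Ioo (-t) t
  · rw [winOut_eq_of_mem hx, Complex.norm_real, Real.norm_eq_abs]
    exact hM x hx.2.le
  · rw [winOut_eq_zero_of_not_mem hx, norm_zero]
    exact hM0

/-- RH-FREE.  `‖g_θ‖²_{L²(ℝ)} = ‖𝖪_θ[t]f‖²_{L²(−t,t)} = winNormSq (limKernel θ) t f`. -/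
theorem integral_norm_sq_winOut (θ t : ℝ) (f : ℝ → ℝ) :
    ∫ x, ‖winOut θ t f x‖ ^ 2 = winNormSq (limKernel θ) t f := by
  unfold winNormSq
  rw [← integral_indicator measurableSet_Ioo]
  congr 1 with x
  by_cases hx : x ∈ Ioo (-t) t
  · rw [indicator_of_mem hx, winOut_eq_of_mem hx, Complex.norm_real, Real.norm_eq_abs, sq_abs]
  · rw [indicator_of_notMem hx, winOut_eq_zero_of_not_mem hx, norm_zero, zero_pow two_ne_zero]

/-- RH-FREE.  `Re φ(0) = winNormSq`, `φ = g_θ ⋆ g̃_θ`. -/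
theorem re_autocorr_winOut_zero (θ t : ℝ) (f : ℝ → ℝ) :
    (weilConv (winOut θ t f) (weilReflect (winOut θ t f)) 0).re = winNormSq (limKernel θ) t f := by
  rw [weilConv_weilReflect_apply_zero, Complex.ofReal_re, integral_norm_sq_winOut]

/-! ## §2 The mollified inequality and its limit -/

/-- RH-FREE.  **Step k**: for the test function `g_k = g_θ ⋆ φ_k` (support in `[−t−r_k, t+r_k]`),
`ε(t + r_k) · (φ ⋆ ν_k)(0) ≤ Re W(φ ⋆ ν_k)`, i.e. `ε(t+r_k)‖g_k‖² ≤ Re Q(g_k)` rewritten through the autocorrelation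
identity `g_k ⋆ g̃_k = φ ⋆ ν_k`. -/
theorem weilGroundEnergy_mul_le_re_mollSq (hθ : 1 < θ) (hf : IntegrableOn f (Ioo (-t) t)) (k : ℕ) :
    weilGroundEnergy (t + (bump k).rOut) *
        (weilConv (weilConv (winOut θ t f) (weilReflect (winOut θ t f))) (mollSq k) 0).re ≤
      (weilFunctional (weilConv (weilConv (winOut θ t f) (weilReflect (winOut θ t f))) (mollSq k))).re := by
  have hFm : Measurable (winOut θ t f) := measurable_winOut hθ hf
  have hFi : Integrable (winOut θ t f) := integrable_winOut hθ hf
  have hFs : HasCompactSupport (winOut θ t f) := hasCompactSupport_winOut θ t f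
  obtain ⟨C, hC⟩ := exists_norm_winOut_le hθ hf
  have hT : IsWeilTest (weilConv (winOut θ t f) (moll k)) :=
    isWeilTest_weilConv_moll_of_locallyIntegrable hFi.locallyIntegrable hFs k
  have hsupp : tsupport (weilConv (winOut θ t f) (moll k)) ⊆ Icc (-(t + (bump k).rOut)) (t + (bump k).rOut) :=
    tsupport_weilConv_moll_subset (fun u hu ↦ winOut_eq_zero_of_lt_abs hu) k
  have h := ConnesVanSuijlekom.weilGroundEnergy_mul_le_re hT hsupp
  rw [weilQuadratic_weilConv_moll hFm hFi hFs hC k] at h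
  have h2 := integral_norm_sq_weilConv_moll hFm hFi hFs hC k
  rw [← h2, Complex.ofReal_re]
  exact h

/-- **RH-FREE · `OutputsCoercive` at one window/one θ/one datum** (theory round-2 crux K2): for `t > 0`, `θ > 1` and
`f ∈ L²(−t,t)`, `ε(t)·‖𝖪_θ[t]f‖² ≤ Re Q(g_θ)`.  Nothing here bears on RH (no sign of `ε(t)` is asserted). -/
theorem weilGroundEnergy_mul_winNormSq_le (ht : 0 < t) (hθ : 1 < θ) (hf : MemLp f 2 (winMeasure t)) :
    weilGroundEnergy t * winNormSq (limKernel θ) t f ≤ (weilQuadratic (winOut θ t f)).re := by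
  have hf1 : IntegrableOn f (Ioo (-t) t) := integrableOn_of_memLp_winMeasure hf
  have hAc : Continuous (weilConv (winOut θ t f) (weilReflect (winOut θ t f))) := continuous_autocorr_winOut hθ hf1
  have hAs : HasCompactSupport (weilConv (winOut θ t f) (weilReflect (winOut θ t f))) :=
    hasCompactSupport_weilConv_winOut_weilReflect hθ t f
  have hAI := (hasSum_weilArchIntegral_winOut hθ hf1).1
  -- the three limits
  have hlimW : Tendsto (fun k : ℕ ↦
      (weilFunctional (weilConv (weilConv (winOut θ t f) (weilReflect (winOut θ t f))) (mollSq k))).re) atTop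
      (𝓝 (weilFunctional (weilConv (winOut θ t f) (weilReflect (winOut θ t f)))).re) :=
    (Complex.continuous_re.tendsto _).comp (tendsto_weilFunctional_mollSq hAc hAs hAI)
  have hlim0 : Tendsto (fun k : ℕ ↦
      (weilConv (weilConv (winOut θ t f) (weilReflect (winOut θ t f))) (mollSq k) 0).re) atTop
      (𝓝 (weilConv (winOut θ t f) (weilReflect (winOut θ t f)) 0).re) :=
    (Complex.continuous_re.tendsto _).comp (tendsto_weilConv_mollSq_zero hAc)
  have hlimε : Tendsto (fun k : ℕ ↦ weilGroundEnergy (t + (bump k).rOut)) atTop (𝓝 (weilGroundEnergy t)) := by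
    have h1 : Tendsto (fun k : ℕ ↦ t + (bump k).rOut) atTop (𝓝 t) := by
      simpa using tendsto_const_nhds.add tendsto_bump_rOut
    exact (continuousAt_weilGroundEnergy ht).tendsto.comp h1
  have hle := le_of_tendsto_of_tendsto' (hlimε.mul hlim0) hlimW
    (weilGroundEnergy_mul_le_re_mollSq hθ hf1)
  rw [re_autocorr_winOut_zero] at hle
  exact hle

/-- **RH-FREE · `OutputsCoercive` PROVED** — VERBATIM the route item of theory round 2 (rh-dbr-theory g10,
`Theses.ThetaFlowDecay.OutputsCoercive`, HOME/rh-dbr-theory/round2/Sketch.lean): for every `t > 0`, `θ > 1`,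
`f ∈ L²(−t,t)`: `ε(t) · winNormSq (limKernel θ) t f ≤ Re weilQuadratic (winOut θ t f)`.  Nothing here bears on RH. -/
theorem outputsCoercive :
    ∀ t : ℝ, 0 < t → ∀ θ : ℝ, 1 < θ → ∀ f : ℝ → ℝ, MemLp f 2 (winMeasure t) →
      weilGroundEnergy t * winNormSq (limKernel θ) t f ≤ (weilQuadratic (winOut θ t f)).re :=
  fun _ ht _ hθ _ hf ↦ weilGroundEnergy_mul_winNormSq_le ht hθ hf

/-! ## §3 The card's extension step `WeilNonnegOnOutputs` -/

/-- RH-FREE.  An empty window (`t ≤ 0`) has output `0`. -/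
theorem winOut_of_nonpos (ht : t ≤ 0) (θ : ℝ) (f : ℝ → ℝ) : winOut θ t f = 0 := by
  funext x
  exact winOut_eq_zero_of_not_mem fun h ↦ by linarith [h.1, h.2]

/-- **RH-FREE · THE EXTENSION STEP OF THE CARD, PROVED for every window**: `WeilNonnegOnOutputs t` — Weil positivity on
the smooth tests of the window `[−t,t]` extends to the rough outputs `g_θ` (`ε(t) ≥ 0` by
`weilGroundEnergy_nonneg_iff_holds`, then `OutputsCoercive`).  The hypothesis `WeilPositivityOn t` is a TREE THEOREM for
`t ≤ 1` (`WeilFormatCData.A1.weilPositivityOn_one`) and RH-EQUIVALENT for all `t`; nothing here bears on RH. -/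
theorem weilNonnegOnOutputs (t : ℝ) : WeilNonnegOnOutputs t := by
  intro hW θ hθ f hf
  rcases le_or_gt t 0 with ht | ht
  · rw [winOut_of_nonpos ht, weilQuadratic_zero, Complex.zero_re]
  · have hε : 0 ≤ weilGroundEnergy t := (weilGroundEnergy_nonneg_iff_holds ht).2 hW
    exact le_trans (mul_nonneg hε (winNormSq_nonneg _ _ _)) (weilGroundEnergy_mul_winNormSq_le ht hθ hf)

end Summit.RiemannHypothesis.RiemannHypothesis.Theorems.SuzukiThetaFlow

end
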